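import Summits.BirchSwinnertonDyer.BirchSwinnertonDyer.Theorems.ManinLocalTwoThreeKummerCubeRootSigmaIdentification
import HarnessLib

/-!
# (AN2-b, ∀-lift form) The cube root of the Kummer cube series is `κ·t_s·W_u(c·E_f)` for EVERY analytic lift `u` of `T`
(route `ManinLocalTwoThree`, crux C3 `ManinPrimeToThreeAtNine` stmt-BirchSwinnertonDyer-22968; cell bsd-f2-manin, p2 gen 17;
`--supports stmt-BirchSwinnertonDyer-22968`)

`exists_hasSum_const_mul_shortT_mul_sigmaCubeRoot_of_lift`: the landed AN2-b (`…SigmaIdentification`, p727852) produced ITS OWN lift `u` of the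
`3`-torsion point (via S6 `shortThreeTorsionLift`); the typed pieces (DICT)/(INV)/(WL) of the witness line quantify over an ARBITRARY lift
(`u ∉ Λ`, `3u = m₁ω₁ + m₂ω₂`, `c²℘(u) = X₀`, `c³℘′(u)/2 = Y₀`) — refuter ref1 §R174's «∀-lift vs ∃-lift» note.  The identification argument never used
the particular lift, so here it is re-run for a given one (`℘′(u) ≠ 0` because `Y₀ ≠ 0`, read off from S6 for some lift): for `Im τ > B`,
`Σ hₙ𝕢₁(τ)ⁿ = κ·t_s(τ)·W_{u, m₁η₁+m₂η₂}(c·E_f(τ))`, `κ ≠ 0`.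
HONEST FRAMING.  Kernel input of (DICT) `KummerMinimalDictionary`; BSD is not proved by this; Manin's conjecture is not proved; C2 and C3 remain OPEN.
[folklore]
-/

set_option autoImplicit false
-- lint-debt: the directory name repeats the summit name (sibling precedent `ManinLocalTwoThreeKummerCubeRootSigmaIdentification.lean`)
set_option linter.dupNamespace false

noncomputable section

open scoped Topology PeriodPair
open Complex Filter PowerSeries
open Literature.NumberTheory.EllipticCurves Literature.NumberTheory.EllipticCurves.ModularForms
open Summit.BirchSwinnertonDyer.Rank1Residual.ManinAdditive.CuspidalKummer
open Summit.BirchSwinnertonDyer.Rank1Residual.ManinAdditive.CuspidalKummerThree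
open Summit.BirchSwinnertonDyer.Rank1Residual.ManinAdditive.KummerCubeMonodromy
open Summit.BirchSwinnertonDyer.BirchSwinnertonDyer.Theorems.ManinLocalTwoThree.KummerCubeAnalytic
open Summit.BirchSwinnertonDyer.BirchSwinnertonDyer.Theorems.ManinLocalTwoThree.KummerCubeSigmaLeaves

namespace Summit.BirchSwinnertonDyer.BirchSwinnertonDyer.Theorems.ManinLocalTwoThree.KummerCubeRootDictionary

/-- **AN2-b for an arbitrary lift `u`.**  See the file header. [folklore] -/
theorem exists_hasSum_const_mul_shortT_mul_sigmaCubeRoot_of_lift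
    (W : WeierstrassCurve ℚ) [W.IsElliptic] [W.IsGloballyMinimal] {N : ℕ} [NeZero N]
    (D : ModularParametrizationData W N) (a : ℕ → ℤ) (ha : ∀ n, (a n : ℂ) = cuspCoeff D.f n)
    (X₀ Y₀ : ℚ) (hT : IsShortThreeTorsion W D.c X₀ Y₀)
    {u : ℂ} (hu : u ∉ D.L.lattice) {m₁ m₂ : ℤ} (h3u : 3 * u = m₁ * D.L.ω₁ + m₂ * D.L.ω₂)
    (hX : (D.c : ℂ) ^ 2 * ℘[D.L] u = (X₀ : ℂ)) (hY : (D.c : ℂ) ^ 3 * ℘'[D.L] u / 2 = (Y₀ : ℂ))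
    (z : ℚ⟦X⟧) (hz : IsParamGerm W D.c a z)
    (h : ℚ⟦X⟧) (hh3 : h ^ 3 = kummerCubeSeries W D.c X₀ Y₀ z) (hh0 : constantCoeff h = -1) :
    ∃ (κ : ℂ) (B : ℝ), κ ≠ 0 ∧
      ∀ τ : UpperHalfPlane, B < τ.im →
        HasSum (fun n : ℕ => ((coeff n h : ℚ) : ℂ) * Function.Periodic.qParam 1 (τ : ℂ) ^ n)
          (κ * (shortT D τ * sigmaCubeRoot D.L u (m₁ * D.L.η₁ + m₂ * D.L.η₂) ((D.c : ℂ) * eichlerIntegral D.f τ))) := by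
  -- the GIVEN lift `u`; `℘′(u) ≠ 0` since `Y₀ ≠ 0` (S6 for some lift)
  obtain ⟨hc0, u₀, -, -, h℘'u₀, -, hY₀⟩ := shortThreeTorsionLift W D X₀ Y₀ hT
  have hc : (D.c : ℂ) ≠ 0 := Int.cast_ne_zero.mpr hc0
  have h℘'u : ℘'[D.L] u ≠ 0 := by
    intro h0
    have hY0 : (Y₀ : ℂ) = 0 := by rw [← hY, h0]; simp
    apply h℘'u₀
    have h1 : (D.c : ℂ) ^ 3 * ℘'[D.L] u₀ / 2 = 0 := by rw [hY₀, hY0]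
    rcases mul_eq_zero.mp (div_eq_zero_iff.mp h1 |>.resolve_right two_ne_zero) with h2 | h2
    · exact absurd h2 (pow_ne_zero 3 hc)
    · exact h2
  set e : ℂ := m₁ * D.L.η₁ + m₂ * D.L.η₂ with he
  -- S3 and S3′
  obtain ⟨C, hC0, hS3⟩ := sigmaTangentLineIdentity D.L u m₁ m₂ hu h3u
  have hS3' := tangentLineScaling W D X₀ Y₀ u hX hY h℘'u
  -- prelims: `t_s·W = Φ(w)` with `Φ` analytic at `0`
  obtain ⟨Φ, P₃, hΦan, hΦ0, hP₃d, hP₃0, hΦeq⟩ := exists_analytic_shortT_mul_sigmaCubeRoot D hc0 hu e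
  -- AN2-a: the holomorphic cube root `R` with `q`-coefficients `hₙ`
  obtain ⟨R, B₁, hRan, hR0, hR⟩ := exists_hasSum_cubeRoot_kummerCubeSeries W D a ha hc0 X₀ Y₀ z hz h hh3 hh0
  -- `q → 0`: `w = c·ε(q) ∉ Λ` and `P₃(w) ≠ 0`
  have hf1 : cuspCoeff D.f 1 = 1 := by
    rw [D.isNewformOf.2 1, W.isMultiplicative_LFunction.map_one]; simp
  have hev := eventually_smul_qGerm_notMem D.f hf1 D.L hc hP₃d.continuous.continuousAt (by rw [hP₃0]; norm_num)
  obtain ⟨B₂, hB₂⟩ := exists_im_bound_of_eventually hev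
  -- the cube identity high in the strip: `R(q)³ = K·Φ(w)³`, `K = c³C`
  set K : ℂ := (D.c : ℂ) ^ 3 * C with hK
  set Ψ : ℂ → ℂ := fun q => Φ ((D.c : ℂ) * qGerm D.f q) with hΨ
  have hΨan : AnalyticAt ℂ Ψ 0 := by
    have hinner : AnalyticAt ℂ (fun q : ℂ => (D.c : ℂ) * qGerm D.f q) 0 :=
      analyticAt_const.mul (analyticAt_qGerm D.f)
    have h0 : (fun q : ℂ => (D.c : ℂ) * qGerm D.f q) 0 = 0 := by simp [qGerm_zero]
    have hcomp : AnalyticAt ℂ (Φ ∘ fun q : ℂ => (D.c : ℂ) * qGerm D.f q) 0 := hΦan.comp_of_eq hinner h0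
    rw [hΨ]
    exact hcomp
  have hΨ0 : Ψ 0 = Φ 0 := by simp [hΨ, qGerm_zero]
  have hΨτ : ∀ τ : UpperHalfPlane, Ψ (Function.Periodic.qParam 1 (τ : ℂ)) = Φ ((D.c : ℂ) * eichlerIntegral D.f τ) := by
    intro τ; simp [hΨ, qGerm_apply]
  have hcube : ∀ τ : UpperHalfPlane, max B₁ B₂ < τ.im →
      R (Function.Periodic.qParam 1 (τ : ℂ)) ^ 3 = K * Ψ (Function.Periodic.qParam 1 (τ : ℂ)) ^ 3 := by
    intro τ hτ
    have h1 : B₁ < τ.im := (le_max_left _ _).trans_lt hτ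
    have h2 : B₂ < τ.im := (le_max_right _ _).trans_lt hτ
    obtain ⟨hwΛ, hP₃w⟩ := hB₂ τ h2
    rw [qGerm_apply] at hwΛ hP₃w
    rw [(hR τ h1).2.1, hS3' τ, hS3 _ hwΛ, hΨτ, ← hΦeq τ hwΛ hP₃w, hK]
    ring
  have hev3 : ∀ᶠ q in 𝓝[≠] (0 : ℂ), R q ^ 3 = K * Ψ q ^ 3 := eventually_nhdsWithin_of_forall_im_gt hcube
  -- at `q = 0` by continuity, hence on a full neighbourhood
  have h0 : R 0 ^ 3 = K * Ψ 0 ^ 3 :=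
    eq_at_zero_of_eventuallyEq (F := fun q => R q ^ 3) (G := fun q => K * Ψ q ^ 3)
      (hRan.continuousAt.pow 3) (continuousAt_const.mul (hΨan.continuousAt.pow 3)) hev3
  have hfull : ∀ᶠ q in 𝓝 (0 : ℂ), R q ^ 3 = K * Ψ q ^ 3 := by
    have h' := eventually_nhdsWithin_iff.mp hev3
    filter_upwards [h'] with q hq
    by_cases hq0 : q = 0
    · subst hq0; exact h0
    · exact hq hq0
  -- the constant `κ`
  have hΨ0ne : Ψ 0 ≠ 0 := by rw [hΨ0]; exact hΦ0
  set κ : ℂ := R 0 / Ψ 0 with hκdef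
  have hκ0 : κ ≠ 0 := div_ne_zero (by rw [hR0]; norm_num) hΨ0ne
  have hκ3 : κ ^ 3 = K := by
    rw [hκdef, div_pow, div_eq_iff (pow_ne_zero 3 hΨ0ne)]
    exact h0
  -- `κΨ` and `R`: equal cubes near `0`, equal values at `0`, hence equal Taylor series, hence equal near `0`
  have hGan : AnalyticAt ℂ (fun q => κ * Ψ q) 0 := analyticAt_const.mul hΨan
  have hT : taylorAt0 (fun q => κ * Ψ q) = taylorAt0 R := by
    have hpow : taylorAt0 (fun q => κ * Ψ q) ^ 3 = taylorAt0 R ^ 3 := by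
      rw [← taylorAt0_pow hGan 3, ← taylorAt0_pow hRan 3]
      apply taylorAt0_congr
      filter_upwards [hfull] with q hq
      rw [mul_pow, hκ3, hq]
    have hcc : constantCoeff (taylorAt0 (fun q => κ * Ψ q)) = constantCoeff (taylorAt0 R) := by
      rw [constantCoeff_taylorAt0, constantCoeff_taylorAt0, hκdef, div_mul_cancel₀ _ hΨ0ne]
    refine eq_of_pow_eq_of_constantCoeff_eq three_ne_zero hpow hcc ?_
    rw [hcc, constantCoeff_taylorAt0, hR0]; norm_num
  have heq := eventuallyEq_of_taylorAt0_eq hGan hRan hT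
  obtain ⟨B₃, hB₃⟩ := exists_im_bound_of_eventually (heq.filter_mono nhdsWithin_le_nhds)
  -- assemble
  refine ⟨κ, max (max B₁ B₂) B₃, hκ0, fun τ hτ => ?_⟩
  have h12 : max B₁ B₂ < τ.im := (le_max_left _ _).trans_lt hτ
  have h1 : B₁ < τ.im := (le_max_left _ _).trans_lt h12
  have h2 : B₂ < τ.im := (le_max_right _ _).trans_lt h12
  have h3 : B₃ < τ.im := (le_max_right _ _).trans_lt hτ
  obtain ⟨hwΛ, hP₃w⟩ := hB₂ τ h2
  rw [qGerm_apply] at hwΛ hP₃w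
  have hsum := (hR τ h1).1
  rw [← hB₃ τ h3, hΨτ τ, ← hΦeq τ hwΛ hP₃w] at hsum
  exact hsum

end Summit.BirchSwinnertonDyer.BirchSwinnertonDyer.Theorems.ManinLocalTwoThree.KummerCubeRootDictionary

end
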